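import Literature.MathematicalPhysics.QuantumFieldTheory.Balaban1983to89.AveragingRT
import Literature.MathematicalPhysics.QuantumFieldTheory.Balaban1985CMP102.SectBLowerBound

/-!
# `Balaban1983to89.B10Eq47AxialChi` — [Balaban1985UV3] (47) p. 267: print's `χ_k` («|U_k(∂p) − 1| < g_kp(g_k)η², p ⊂ T_η»,
# the MINIMIZER's plaquettes) versus the Introduction's `χ` of (4) («|U(∂p) − 1| < ε₁», the FIELD's plaquettes) — the
# non-abelian Stokes inequality for the axial (decimation) averaging on `Setup`'s torus, and the inclusion
# «(47)-domain ⊆ (4)-domain» (`SectB.TowerObjects.Chi47SubChi4`) as a THEOREM for axially averaged towers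

T. Bałaban, *Ultraviolet stability of three-dimensional lattice pure gauge field theories*, Commun. Math. Phys. **102**
(1985) 255–275 [Balaban1985UV3] (cell paper B10; journal page = PDF page + 254).  Cell `pub-ymgap` (HUMAN RULING D-0062,
YM Track A), seat `pub-ymgap-dag-n08-b` (-b FIRST-MISSING-ESTIMATE lane of DAG node N08 = [B10] Thm 1 p. 257 ∕ Thm 2 p. 272),
generation 2; filed `--supports stmt-QuantumFields-19183`.  `bears_on: R4∕N08`.

## What print says, and the located gap this file addresses

(47) p. 267 = PDF 13 L17–20: «Analogously to (37) we assume the lower bound ρ_k(V) ≥ χ_k exp[−(1/g_k²)A^η(U_k) + Σ_{j=1}^k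
Σ_{Y_j} 𝒫_j(Y_j, U_k) − E_k − Σ_{j=0}^{k−1} O((L^jε)^{3+κ₀})|T₁^{(j)}|], (47) where the characteristic function χ_k corresponds to
the restrictions on V given by the conditions |U_k(∂p) − 1| < g_kp(g_k)η², p ⊂ T_η.»  (4) p. 256 = PDF 2 L24–27: «The function
χ(U) is a characteristic function of the domain |U(∂p) − 1| < ε₁, p ⊂ T₁^{(K)}, (4)».  (42) p. 266 = PDF 12 L23–26: «The
configuration U_k is determined by the variational problem considered in [7], i.e. it is a minimum of the functional U →
A^η(U), U: Ū^j = V_j on Λ_j, j = 0, 1, …, k, where we have put Λ₀ = Ω₁ᶜ and V_k = V. (42)» — at the history WITHOUT large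
fields (the only term of (47)) the constraint is the single equation `Ū^k = V` on `T₁^{(k)}` (`\bar{·}` = the averaging of
[4] = [Balaban1985Averaging] (10)∕(15), iterated `k` times from `T_η` to `T₁^{(k)}`).

The 4D cell's typing `B10.Ineq47` and the d = 3 spine's `Balaban1985CMP102.SectB.TowerObjects.Ineq47AsPrinted` carry the
Introduction's `χ` of (4) (threshold `ε₁(k)`) in the place of print's `χ_k`; print does not relate the two functions (cell
`pub-balaban` GAPS G-pv15-1 «unprinted identification of two different printed characteristic functions in the LOWER bound»;
lane `pub-balaban3d` LATENT row G3D-09, typed hypothesis-shaped in `Balaban1985CMP102.SectBLowerBound` as the two inclusions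
`Chi4SubChi47` ∕ `Chi47SubChi4`, never asserted there).

## What this file PROVES (kernel; no `sorry`, no named fact, no new `def … : Prop`)

§1–§3: for the AXIAL (decimation) averaging `AveragingRT.axialAvg` of `Setup` («Ū(c) = U(Γ_c)», the straight product of the
`L` fine bond variables of the line of the coarse bond `c` — the factor `U(c)` of [Balaban1985Averaging] (15); it is the
averaging of the lane's standard external inputs `Balaban3D.Carriers.ExternalInputs.ofStd` ∕ `AveragingRT.stdAvg` in the
standing range `j + 1 ≤ m + K`), the NON-ABELIAN STOKES INEQUALITY on the torus `T^{(j)}`: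
`|Ū(∂p′) − 1| ≤ Σ_{the L×L plaquettes p of T^{(j)} tiling p′} |U(∂p) − 1|` (`dist1_plaqHol_axialAvg_le`; mechanism: a
coarse plaquette variable is the ordered boundary holonomy of an `L × L` square of fine plaquettes; stacking squares
multiplies holonomies up to conjugation, and `|·−1|` is conjugation invariant and subadditive — the `GaugeGroup` axioms
`dist1_conj`, `dist1_mul_le` of `Setup`, [Balaban1985Averaging] (19) p. 21); hence `PlaqSmall δ U → PlaqSmall (L²δ) (Ū)`
(`plaqSmall_axialAvg`) and, for the `k`-fold average `axialUp k : T_η → T₁^{(k)}` (§3), `PlaqSmall (αη²) U → PlaqSmall α (Ū^k)`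
with `η = L^{−k}` — at EQUAL thresholds, with no `C₀α₀²` correction (contrast [Balaban1985Averaging] Prop. 2 (54) p. 26 for
the full non-linear average (43), `B7Prop2Explicit.prop2_explicit`: `< α₀ + 2C₀α₀²`).
§4: over the spine's tower objects `W : Balaban1985CMP102.SectB.TowerObjects S G` — **`W.Chi47SubChi4 k` HOLDS** whenever
(i) the trivial-history minimizer satisfies (42) FOR THE AXIAL AVERAGING, `axialUp k (U_k(V)) = V` for all `V` on `T₁^{(k)}`
(hypothesis `hcons` on the binder `W.UkH k (W.triv k)` = «U_k(V)»: the constraint clause of (42), which the minimizer of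
[Balaban1985Variational] Thm 1 satisfies by construction — exactly what a NODE 00 B10-pin's `wilsonBG_spec` (chair R434 (c2))
states about the pinned minimizer), and (ii) `g_kp(g_k) ≤ ε₁(k)` (`hthr`; the lane pub-balaban3d pins `ε₁(k) = g_kp(g_k)`,
`Carriers.eps1Of`, equality); consequently (`SectBLowerBound.ineq47Literal_of_asPrinted`) **the tree's (47) with the
Introduction's `χ` implies (47) AS PRINTED with `χ_k`** (`ineq47Literal_of_asPrinted_axial`), also for the pinned objects
`W.pin` whose slot «ρ_k satisfies (41), (47)» is the tree's `(41)_k ∧ (47)_k` (`ineq47Literal_of_slot_pin`); §4b states (42)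
for the run's OWN averaging operations `W.av` (`avgUp`), axial in the standing range — in particular for
`W.av = AveragingRT.stdAvg`, the lane's standard external inputs (`ineq47Literal_of_asPrinted_stdAvg`).
§5: the CONVERSE inclusion `Chi4SubChi47` from the regularity of the minimizer in the SHAPE of [Balaban1985Variational]
Thm 1 (8) with (2) p. 278 («|U(∂p) − 1| < ε₀L^{−2j}» on `Ω_j`, no large fields: `|U_k(∂p) − 1| < B₃ε₁η²` on `T_η`) as an
explicit hypothesis `hreg` (in-edge b11 of the node; NOT proved here), at thresholds `B₃ε₁(k) ≤ g_kp(g_k)`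
(`chi4SubChi47_of_regularity`) — recorded to make the asymmetry visible: at the lane's `ε₁(k) = g_kp(g_k)` only §4's
direction is available (`B₃ ≥ 1` in [7]).

## Honest scope

(a) The averaging is the axial DECIMATION `axialAvg`, the tree's inhabitant of `Setup.Averaging` — NOT the weighted
block average (15)∕(43) of [Balaban1985Averaging] that print's `\bar{·}` denotes (cell DIVERGENCE F6; for that average the
inclusion holds only with the (54) loss, `B7Prop2Explicit`).  (b) Standing range: every statement about level `j → j+1` carries
`j + 1 ≤ m + K` (the tori degenerate beyond).  (c) `hcons`, `hthr`, `hreg` are hypotheses on binders; nothing of (41)∕(47),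
Thm 1 or Thm 2 is asserted; the node `Dag.B10_main` is untouched (count-neutral).  (d) One finite torus per statement;
nothing continuum ∕ ℝ³∕ℝ⁴ ∕ OS ∕ mass gap ∕ Clay.  Helper lemmas on the torus geometry are `private` ([folklore]) or definitional unfoldings of the cited objects.
-/

noncomputable section

open scoped BigOperators

namespace Literature.MathematicalPhysics.QuantumFieldTheory.Balaban1983to89.B10Eq47AxialChi

open AveragingRT (lineSite line pathProd axialAvg lineSite_succ lineSite_zero lineSite_L)

variable {P : Params} {j : ℕ}

/-! ## §1 Torus geometry: iterated shifts, straight products, rectangle holonomies -/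

/-- `x + n e_μ` on the torus `T^{(j)}`: the `n`-fold shift (the sites of a straight lattice path; [Balaban1984PropagatorsI]
(1.7) «[x, x(c)]»). [cite: Balaban1984PropagatorsI, (1.7) p.18] -/
def shiftN (x : Site P j) (μ : Fin P.d) : ℕ → Site P j
  | 0 => x
  | n + 1 => (shiftN x μ n).shift μ

/-- `shiftN x μ 0 = x` (the path of (1.7) starts at `x`). [cite: Balaban1984PropagatorsI, (1.7) p.18] -/
@[simp] theorem shiftN_zero (x : Site P j) (μ : Fin P.d) : shiftN x μ 0 = x := rfl

/-- `shiftN x μ (n+1) = (shiftN x μ n) + e_μ` (the next site of the straight path (1.7)). [cite: Balaban1984PropagatorsI, (1.7) p.18] -/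
theorem shiftN_succ (x : Site P j) (μ : Fin P.d) (n : ℕ) : shiftN x μ (n + 1) = (shiftN x μ n).shift μ := rfl

/-- Unit shifts in two directions commute on the torus. [folklore] -/
private theorem shift_comm (x : Site P j) (μ ν : Fin P.d) : (x.shift μ).shift ν = (x.shift ν).shift μ := by
  funext κ
  by_cases hκν : κ = ν
  · subst hκν
    by_cases hκμ : κ = μ
    · subst hκμ; rfl
    · simp [Site.shift, Function.update_apply, hκμ]
  · by_cases hκμ : κ = μ
    · subst hκμ
      simp [Site.shift, Function.update_apply, hκν]
    · simp [Site.shift, Function.update_apply, hκμ, hκν]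

/-- An `n`-fold shift commutes with a unit shift. [folklore] -/
private theorem shiftN_shift (x : Site P j) (μ ν : Fin P.d) :
    ∀ n : ℕ, shiftN (x.shift ν) μ n = (shiftN x μ n).shift ν
  | 0 => rfl
  | n + 1 => by rw [shiftN_succ, shiftN_succ, shiftN_shift x μ ν n, shift_comm]

/-- Iterated shifts in two directions commute. [folklore] -/
private theorem shiftN_comm (x : Site P j) (μ ν : Fin P.d) (n : ℕ) :
    ∀ m : ℕ, shiftN (shiftN x ν m) μ n = shiftN (shiftN x μ n) ν m
  | 0 => rfl
  | m + 1 => by rw [shiftN_succ, shiftN_succ, shiftN_shift, shiftN_comm x μ ν n m]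

variable {G : Type*} [GaugeGroup G]

/-- The ordered product `U(x, x+e_μ) U(x+e_μ, x+2e_μ) ⋯` of `n` bond variables along the straight path from `x` in
direction `μ` (the parallel transport «U(Γ)» of [Balaban1985Averaging] (9) p. 19 along a straight contour). [cite: Balaban1985Averaging, (9) p.19] -/
def rowProd (U : GaugeField P j G) (x : Site P j) (μ : Fin P.d) : ℕ → G
  | 0 => 1
  | n + 1 => rowProd U x μ n * U ⟨shiftN x μ n, μ⟩

/-- `rowProd U x μ 0 = 1` (empty transport, (9)). [cite: Balaban1985Averaging, (9) p.19] -/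
@[simp] theorem rowProd_zero (U : GaugeField P j G) (x : Site P j) (μ : Fin P.d) : rowProd U x μ 0 = 1 := rfl

/-- `rowProd U x μ (n+1) = rowProd U x μ n · U(x + n e_μ, x + (n+1) e_μ)` (the transport (9) extended by one bond). [cite: Balaban1985Averaging, (9) p.19] -/
theorem rowProd_succ (U : GaugeField P j G) (x : Site P j) (μ : Fin P.d) (n : ℕ) :
    rowProd U x μ (n + 1) = rowProd U x μ n * U ⟨shiftN x μ n, μ⟩ := rfl

/-- The boundary holonomy `U(∂R)` of the `a × b` rectangle `R` of plaquettes with corner `x`, sides `a e_μ`, `b e_ν`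
(the plaquette variable (9) p. 19 of [Balaban1985Averaging] for a big square when `a = b = L`). [cite: Balaban1985Averaging, (9) p.19] -/
def rect (U : GaugeField P j G) (x : Site P j) (μ ν : Fin P.d) (a b : ℕ) : G :=
  rowProd U x μ a * rowProd U (shiftN x μ a) ν b * (rowProd U (shiftN x ν b) μ a)⁻¹ * (rowProd U x ν b)⁻¹

/-- The `1 × 1` rectangle holonomy is the plaquette variable (9) `U(∂p) = U(x,x+e_μ)U(x+e_μ,x+e_μ+e_ν)U(x+e_ν,x+e_μ+e_ν)⁻¹U(x,x+e_ν)⁻¹`.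
[cite: Balaban1985Averaging, (9) p.19] -/
theorem rect_one_one (U : GaugeField P j G) (x : Site P j) {μ ν : Fin P.d} (h : μ < ν) :
    rect U x μ ν 1 1 = GaugeField.plaqHol U ⟨x, μ, ν, h⟩ := by
  simp [rect, rowProd, GaugeField.plaqHol, shiftN]

/-- Stacking one more row of plaquettes in direction `ν`: `U(∂R_{a,b+1}) = U(∂R_{a,b}) · [h U(∂R′_{a,1}) h⁻¹]` with
`R′` the `a × 1` strip at height `b` and `h` the transport from `x` to `x + b e_ν`. [folklore] -/
private theorem rect_succ_right (U : GaugeField P j G) (x : Site P j) (μ ν : Fin P.d) (a b : ℕ) :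
    rect U x μ ν a (b + 1) =
      rect U x μ ν a b * (rowProd U x ν b * rect U (shiftN x ν b) μ ν a 1 * (rowProd U x ν b)⁻¹) := by
  simp only [rect, rowProd_succ, rowProd_zero, one_mul, shiftN_comm x μ ν a b, shiftN_succ, shiftN_zero]
  group

/-- Stacking one more plaquette in direction `μ` onto an `a × 1` strip:
`U(∂R_{a+1,1}) = [h U(∂p_a) h⁻¹] · U(∂R_{a,1})`, `p_a` the plaquette at `x + a e_μ`, `h` the transport from `x` to
`x + a e_μ`. [folklore] -/
private theorem rect_succ_left (U : GaugeField P j G) (x : Site P j) {μ ν : Fin P.d} (h : μ < ν) (a : ℕ) :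
    rect U x μ ν (a + 1) 1 =
      (rowProd U x μ a * GaugeField.plaqHol U ⟨shiftN x μ a, μ, ν, h⟩ * (rowProd U x μ a)⁻¹) * rect U x μ ν a 1 := by
  simp only [rect, rowProd_succ, rowProd_zero, one_mul, GaugeField.plaqHol, shiftN_succ, shiftN_zero,
    shiftN_shift x μ ν a]
  group

/-! ## §2 The non-abelian Stokes inequality -/

/-- `|U(∂R_{a,1}) − 1| ≤ Σ_{s<a} |U(∂p_s) − 1|` for the `a × 1` strip (plaquettes `p_s` at `x + s e_μ`). [folklore] -/
private theorem dist1_rect_one_le (U : GaugeField P j G) (x : Site P j) {μ ν : Fin P.d} (h : μ < ν) :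
    ∀ a : ℕ, dist1 (rect U x μ ν a 1) ≤
      ∑ s ∈ Finset.range a, dist1 (GaugeField.plaqHol U ⟨shiftN x μ s, μ, ν, h⟩)
  | 0 => by simp [rect, rowProd, GaugeGroup.dist1_one]
  | a + 1 => by
    rw [rect_succ_left U x h a, Finset.sum_range_succ]
    calc dist1 (rowProd U x μ a * GaugeField.plaqHol U ⟨shiftN x μ a, μ, ν, h⟩ * (rowProd U x μ a)⁻¹ *
            rect U x μ ν a 1)
        ≤ dist1 (rowProd U x μ a * GaugeField.plaqHol U ⟨shiftN x μ a, μ, ν, h⟩ * (rowProd U x μ a)⁻¹) +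
            dist1 (rect U x μ ν a 1) := GaugeGroup.dist1_mul_le _ _
      _ = dist1 (GaugeField.plaqHol U ⟨shiftN x μ a, μ, ν, h⟩) + dist1 (rect U x μ ν a 1) := by
            rw [GaugeGroup.dist1_conj]
      _ ≤ _ := by linarith [dist1_rect_one_le U x h a]

/-- **Non-abelian Stokes on the torus** for an `a × b` rectangle: `|U(∂R_{a,b}) − 1| ≤ Σ_{t<b} Σ_{s<a} |U(∂p_{s,t}) − 1|`,
`p_{s,t}` the plaquette at `x + s e_μ + t e_ν` (conjugation invariance and subadditivity of `|· − 1|`,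
[Balaban1985Averaging] (19) p. 21; the «elementary reasoning» of [Balaban1985RegularSpaces] Lemma 1 p. 79). [cite: Balaban1985Averaging, (19) p.21] -/
theorem dist1_rect_le (U : GaugeField P j G) (x : Site P j) {μ ν : Fin P.d} (h : μ < ν) (a : ℕ) :
    ∀ b : ℕ, dist1 (rect U x μ ν a b) ≤
      ∑ t ∈ Finset.range b, ∑ s ∈ Finset.range a,
        dist1 (GaugeField.plaqHol U ⟨shiftN (shiftN x ν t) μ s, μ, ν, h⟩)
  | 0 => by simp [rect, rowProd, GaugeGroup.dist1_one]
  | b + 1 => by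
    rw [rect_succ_right U x μ ν a b, Finset.sum_range_succ]
    calc dist1 (rect U x μ ν a b * (rowProd U x ν b * rect U (shiftN x ν b) μ ν a 1 * (rowProd U x ν b)⁻¹))
        ≤ dist1 (rect U x μ ν a b) +
            dist1 (rowProd U x ν b * rect U (shiftN x ν b) μ ν a 1 * (rowProd U x ν b)⁻¹) :=
          GaugeGroup.dist1_mul_le _ _
      _ = dist1 (rect U x μ ν a b) + dist1 (rect U (shiftN x ν b) μ ν a 1) := by rw [GaugeGroup.dist1_conj]
      _ ≤ _ := add_le_add (dist1_rect_le U x h a b) (dist1_rect_one_le U (shiftN x ν b) h a)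

/-! ## §3 The axial average: one coarse plaquette is an `L × L` square of fine ones -/

/-- The sites of the line of a coarse bond are the iterated shifts of the block centre: `lineSite c t = emb c₋ + t e_μ`.
[cite: Balaban1984PropagatorsI, (1.7) p.18] -/
theorem lineSite_eq_shiftN (c : PBond P (j + 1)) : ∀ t : ℕ, lineSite c t = shiftN (emb c.src) c.dir t
  | 0 => by simp
  | t + 1 => by rw [lineSite_succ, lineSite_eq_shiftN c t, shiftN_succ]

/-- The straight product of `AveragingRT` is the row product from the block centre: `pathProd U c n = rowProd U (emb c₋) μ n`.
[cite: Balaban1984PropagatorsI, (1.7) p.18] -/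
theorem pathProd_eq_rowProd (U : GaugeField P j G) (c : PBond P (j + 1)) :
    ∀ n : ℕ, pathProd U c n = rowProd U (emb c.src) c.dir n
  | 0 => rfl
  | n + 1 => by
    rw [rowProd_succ, ← lineSite_eq_shiftN]
    exact congrArg (· * U (line c n)) (pathProd_eq_rowProd U c n)

/-- Centres of neighbouring blocks are `L` fine steps apart: `emb (y + e_μ) = emb y + L e_μ` (standing range). [cite: Balaban1987RG1, (0.1) p.252] -/
theorem emb_shift (hj : j + 1 ≤ P.m + P.K) (y : Site P (j + 1)) (μ : Fin P.d) :
    emb (y.shift μ) = shiftN (emb y) μ P.L := by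
  rw [← lineSite_eq_shiftN ⟨y, μ⟩ P.L, lineSite_L hj]
  rfl

/-- **A coarse plaquette variable of the axial average is the boundary holonomy of the `L × L` square of fine
plaquettes** based at the centre of the block of its corner: `Ū(∂p′) = U(∂R_{L,L}(emb p′₋))` (standing range).
[cite: Balaban1985Averaging, (9)–(10) p.19] -/
theorem plaqHol_axialAvg_eq_rect (hj : j + 1 ≤ P.m + P.K) (U : GaugeField P j G) (p : Plaq P (j + 1)) :
    GaugeField.plaqHol (axialAvg U) p = rect U (emb p.src) p.μ p.ν P.L P.L := by
  simp only [GaugeField.plaqHol, axialAvg, pathProd_eq_rowProd, rect, emb_shift hj]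

/-- **NON-ABELIAN STOKES FOR THE AXIAL AVERAGE** (standing range `j + 1 ≤ m + K`): for every configuration `U` on `T^{(j)}`
and every plaquette `p′` of `T^{(j+1)}`,
`|Ū(∂p′) − 1| ≤ Σ_{t<L} Σ_{s<L} |U(∂p_{s,t}) − 1|`, the sum over the `L × L` plaquettes `p_{s,t}` of `T^{(j)}` (corner
`emb p′₋ + s e_μ + t e_ν`, directions `μ < ν` of `p′`) tiling `p′`. [cite: Balaban1985Averaging, (9)–(10) p.19 + (19) p.21] -/
theorem dist1_plaqHol_axialAvg_le (hj : j + 1 ≤ P.m + P.K) (U : GaugeField P j G) (p : Plaq P (j + 1)) :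
    dist1 (GaugeField.plaqHol (axialAvg U) p) ≤
      ∑ t ∈ Finset.range P.L, ∑ s ∈ Finset.range P.L,
        dist1 (GaugeField.plaqHol U ⟨shiftN (shiftN (emb p.src) p.ν t) p.μ s, p.μ, p.ν, p.hμν⟩) := by
  rw [plaqHol_axialAvg_eq_rect hj]
  exact dist1_rect_le U (emb p.src) p.hμν P.L P.L

/-- Uniform form: if every plaquette variable of `U` is within `δ` of `1`, every plaquette variable of `Ū` is within
`L²·δ` of `1`. [cite: Balaban1985Averaging, (9)–(10) p.19 + (19) p.21] -/
theorem dist1_plaqHol_axialAvg_le_sq (hj : j + 1 ≤ P.m + P.K) (U : GaugeField P j G) {δ : ℝ}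
    (hU : ∀ q : Plaq P j, dist1 (GaugeField.plaqHol U q) ≤ δ) (p : Plaq P (j + 1)) :
    dist1 (GaugeField.plaqHol (axialAvg U) p) ≤ (P.L : ℝ) ^ 2 * δ := by
  refine (dist1_plaqHol_axialAvg_le hj U p).trans ?_
  calc ∑ t ∈ Finset.range P.L, ∑ s ∈ Finset.range P.L,
          dist1 (GaugeField.plaqHol U ⟨shiftN (shiftN (emb p.src) p.ν t) p.μ s, p.μ, p.ν, p.hμν⟩)
      ≤ ∑ _t ∈ Finset.range P.L, ∑ _s ∈ Finset.range P.L, δ :=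
        Finset.sum_le_sum fun t _ => Finset.sum_le_sum fun s _ => hU _
    _ = (P.L : ℝ) ^ 2 * δ := by simp [Finset.sum_const, Finset.card_range]; ring

/-- **`PlaqSmall δ U → PlaqSmall (L²δ) Ū`** for the axial average (standing range): the small-field domain of threshold `δ`
on `T^{(j)}` averages into the small-field domain of threshold `L²δ` on `T^{(j+1)}` — EQUAL scaled thresholds, no second-order
loss. [cite: Balaban1985Averaging, (9)–(10) p.19 + (19) p.21] -/
theorem plaqSmall_axialAvg (hj : j + 1 ≤ P.m + P.K) {δ : ℝ} {U : GaugeField P j G} (hU : PlaqSmall δ U) :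
    PlaqSmall ((P.L : ℝ) ^ 2 * δ) (axialAvg U) := by
  intro p
  refine (dist1_plaqHol_axialAvg_le hj U p).trans_lt ?_
  have hL : (Finset.range P.L).Nonempty := Finset.nonempty_range_iff.mpr (ne_of_gt P.L_pos)
  calc ∑ t ∈ Finset.range P.L, ∑ s ∈ Finset.range P.L,
          dist1 (GaugeField.plaqHol U ⟨shiftN (shiftN (emb p.src) p.ν t) p.μ s, p.μ, p.ν, p.hμν⟩)
      < ∑ _t ∈ Finset.range P.L, ∑ _s ∈ Finset.range P.L, δ :=
        Finset.sum_lt_sum_of_nonempty hL fun t _ => Finset.sum_lt_sum_of_nonempty hL fun s _ => hU _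
    _ = (P.L : ℝ) ^ 2 * δ := by simp [Finset.sum_const, Finset.card_range]; ring

/-! ## §3b The `k`-fold axial average from `T_η` to `T₁^{(k)}` -/

/-- The `k`-fold axial average `Ū^k : T_η = T^{(0)} → T₁^{(k)} = T^{(k)}` («Ū^k» of (42) p. 266 ∕ [Balaban1985Averaging] (43)
p. 24, for the decimation averaging). [cite: Balaban1985UV3, (42) p.266] -/
def axialUp : (k : ℕ) → GaugeField P 0 G → GaugeField P k G
  | 0 => fun U => U
  | k + 1 => fun U => axialAvg (axialUp k U)

/-- `Ū^0 = U` ((42)∕[Balaban1985Averaging] (43): no averaging at `k = 0`). [cite: Balaban1985UV3, (42) p.266] -/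
@[simp] theorem axialUp_zero (U : GaugeField P 0 G) : axialUp 0 U = U := rfl

/-- `Ū^{k+1} = \overline{Ū^k}` ((42)∕[Balaban1985Averaging] (43), axial averaging). [cite: Balaban1985UV3, (42) p.266] -/
theorem axialUp_succ (k : ℕ) (U : GaugeField P 0 G) : axialUp (k + 1) U = axialAvg (axialUp k U) := rfl

/-- **`PlaqSmall δ U → PlaqSmall ((L²)^k δ) Ū^k`** on `T₁^{(k)}`, `k ≤ m + K`: the `k`-fold form of `plaqSmall_axialAvg`.
[cite: Balaban1985UV3, (42) p.266 + (4) p.256] -/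
theorem plaqSmall_axialUp {δ : ℝ} {U : GaugeField P 0 G} (hU : PlaqSmall δ U) :
    ∀ {k : ℕ}, k ≤ P.m + P.K → PlaqSmall (((P.L : ℝ) ^ 2) ^ k * δ) (axialUp k U)
  | 0, _ => by simpa using hU
  | k + 1, hk => by
    have h := plaqSmall_axialAvg (P := P) (j := k) (by omega) (plaqSmall_axialUp hU (k := k) (by omega))
    rw [axialUp_succ, pow_succ, mul_comm (((P.L : ℝ) ^ 2) ^ k), mul_assoc]
    exact h

/-- The threshold arithmetic of (47): `(L²)^k · (α · η²) = α` for `η = L^{−k}` (`Params.eta`). [cite: Balaban1985UV3, (47) p.267] -/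
theorem sq_pow_mul_eta_sq (k : ℕ) (α : ℝ) : ((P.L : ℝ) ^ 2) ^ k * (α * P.eta k ^ 2) = α := by
  have hL : (P.L : ℝ) ≠ 0 := Nat.cast_ne_zero.mpr (ne_of_gt P.L_pos)
  unfold Params.eta
  rw [← pow_mul, ← pow_mul, inv_pow, mul_comm 2 k]
  field_simp

/-- **THE (47)-RESTRICTION AVERAGES INTO THE (4)-DOMAIN AT THE SAME SCALED THRESHOLD**: if a configuration `U` on `T_η`
satisfies «|U(∂p) − 1| < αη², p ⊂ T_η» (`η = L^{−k}`), then its `k`-fold axial average satisfies «|Ū^k(∂p′) − 1| < α,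
p′ ⊂ T₁^{(k)}» (`k ≤ m + K`). [cite: Balaban1985UV3, (47) p.267 + (4) p.256] -/
theorem plaqSmall_axialUp_eta {k : ℕ} (hk : k ≤ P.m + P.K) {α : ℝ} {U : GaugeField P 0 G}
    (hU : PlaqSmall (α * P.eta k ^ 2) U) : PlaqSmall α (axialUp k U) := by
  have h := plaqSmall_axialUp hU hk
  rwa [sq_pow_mul_eta_sq] at h

/-! ## §4 (47): the tree's `χ` of (4) versus print's `χ_k`, over the spine's tower objects -/

section Spine

open Balaban1985CMP102 Balaban1985CMP102.Setting

variable {L : ℕ} {S : Scales L} {G : Type} [GaugeGroup G] [MeasurableSpace G] [HaarData G]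
  (W : SectB.TowerObjects S G)

omit [MeasurableSpace G] [HaarData G] in
/-- `PlaqSmall` is monotone in the threshold. [folklore] -/
private theorem plaqSmall_mono {i : ℕ} {δ δ' : ℝ} (hδ : δ ≤ δ') {V : GaugeField S.P i G} (hV : PlaqSmall δ V) :
    PlaqSmall δ' V := fun p => (hV p).trans_le hδ

/-- **G3D-09 `Chi47SubChi4` IS A THEOREM FOR AXIALLY AVERAGED TOWERS.**  If the trivial-history minimizer `U_k(V)` of the
tower objects `W` (binder `W.UkH k (W.triv k)`) satisfies the constraint of (42) p. 266 «Ū^k = V» for the axial averaging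
(`hcons`), and `g_kp(g_k) ≤ ε₁(k)` (`hthr`), then print's (47)-restriction «|U_k(∂p) − 1| < g_kp(g_k)η², p ⊂ T_η» on `V`
implies the Introduction's (4) «|V(∂p′) − 1| < ε₁(k), p′ ⊂ T₁^{(k)}»: `W.Chi47SubChi4 k` (`k ≤ m + K`). [cite: Balaban1985UV3, (47) p.267 + (42) p.266 + (4) p.256] -/
theorem chi47SubChi4_of_axial (k : ℕ) (hk : k ≤ S.m + S.K)
    (hcons : ∀ V : GaugeField S.P k G, axialUp k (W.UkH k (W.triv k) V) = V)
    (hthr : S.gk k * B10.pFun W.b₀ W.p₀ (S.gk k) ≤ W.ε₁ k) : W.Chi47SubChi4 k := by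
  intro V hV
  have hk' : k ≤ S.P.m + S.P.K := hk
  have h := plaqSmall_axialUp_eta (P := S.P) hk' (α := S.gk k * B10.pFun W.b₀ W.p₀ (S.gk k))
    (U := W.UkH k (W.triv k) V) hV
  rw [hcons] at h
  exact plaqSmall_mono hthr h

/-- **THE TREE'S (47) DELIVERS (47) AS PRINTED** on axially averaged towers: under `hcons` ((42) at the trivial history for
the axial averaging) and `hthr` (`g_kp(g_k) ≤ ε₁(k)`), the lower bound (47) with the Introduction's `χ` of (4)
(`SectB.TowerObjects.Ineq47AsPrinted W k = B10.Ineq47 W.toTowerRun k`) implies (47) with print's own `χ_k`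
(`SectB.TowerObjects.Ineq47Literal W k`). [cite: Balaban1985UV3, (47) p.267] -/
theorem ineq47Literal_of_asPrinted_axial (k : ℕ) (hk : k ≤ S.m + S.K)
    (hcons : ∀ V : GaugeField S.P k G, axialUp k (W.UkH k (W.triv k) V) = V)
    (hthr : S.gk k * B10.pFun W.b₀ W.p₀ (S.gk k) ≤ W.ε₁ k) (h : W.Ineq47AsPrinted k) : W.Ineq47Literal k :=
  W.ineq47Literal_of_asPrinted k (chi47SubChi4_of_axial W k hk hcons hthr) h

/-- The same read off the PINNED objects `W.pin` (the abstract slot «ρ_k satisfies (41), (47)» set to the tree's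
`(41)_k ∧ (47)_k` of `W`, `SectB.TowerObjects.pin`): if the slot holds at step `k` then (47) AS PRINTED holds for `W`. [cite: Balaban1985UV3, (47) p.267 + Thm 2 p.272] -/
theorem ineq47Literal_of_slot_pin (k : ℕ) (hk : k ≤ S.m + S.K)
    (hcons : ∀ V : GaugeField S.P k G, axialUp k (W.UkH k (W.triv k) V) = V)
    (hthr : S.gk k * B10.pFun W.b₀ W.p₀ (S.gk k) ≤ W.ε₁ k) (hslot : W.pin.ineq41_47 k) : W.Ineq47Literal k :=
  ineq47Literal_of_asPrinted_axial W k hk hcons hthr hslot.2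

/-! ## §4b The same with (42) stated for the run's OWN averaging operations `W.av` -/

/-- The `k`-fold average `Ū^k : T_η → T₁^{(k)}` by the run's own averaging operations `R.av i` (the «\bar{·}» of (42) p. 266,
[Balaban1985Averaging] (10) p. 19, iterated). [cite: Balaban1985UV3, (42) p.266] -/
def avgUp (R : RunObjects S G) : (k : ℕ) → GaugeField S.P 0 G → GaugeField S.P k G
  | 0 => fun U => U
  | k + 1 => fun U => (R.av k).avg (avgUp R k U)

omit [MeasurableSpace G] [HaarData G] in
/-- In the standing range the total standard family `AveragingRT.stdAvg` (the lane pub-balaban3d's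
`Carriers.ExternalInputs.ofStd`) averages axially — by the factor `U(c)` of [Balaban1985Averaging] (15). [cite: Balaban1985Averaging, (15) p.19] -/
theorem stdAvg_avg_of_le {k : ℕ} (hk : k + 1 ≤ S.P.m + S.P.K) :
    (AveragingRT.stdAvg S.P G k).avg = axialAvg := by
  simp only [AveragingRT.stdAvg, dif_pos hk, AveragingRT.axial_avg]

/-- If the run averages axially in the standing range, its `k`-fold average is `axialUp k` (`k ≤ m + K`). [cite: Balaban1985UV3, (42) p.266] -/
theorem avgUp_eq_axialUp (R : RunObjects S G) (hav : ∀ i, i + 1 ≤ S.m + S.K → (R.av i).avg = axialAvg) :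
    ∀ {k : ℕ}, k ≤ S.m + S.K → ∀ U : GaugeField S.P 0 G, avgUp R k U = axialUp k U
  | 0, _, _ => rfl
  | k + 1, hk, U => by
    show (R.av k).avg (avgUp R k U) = axialAvg (axialUp k U)
    rw [hav k hk, avgUp_eq_axialUp R hav (k := k) (by omega) U]

/-- **`Chi47SubChi4` with (42) READ LITERALLY for the run's own averaging**: if `W.av` is axial in the standing range
(`hav`), the trivial-history minimizer satisfies «Ū^k(U_k(V)) = V» with `\bar{·} = W.av` (`hcons`), and `g_kp(g_k) ≤ ε₁(k)`,
then `W.Chi47SubChi4 k`. [cite: Balaban1985UV3, (47) p.267 + (42) p.266 + (4) p.256] -/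
theorem chi47SubChi4_of_avgUp (k : ℕ) (hk : k ≤ S.m + S.K)
    (hav : ∀ i, i + 1 ≤ S.m + S.K → (W.av i).avg = axialAvg)
    (hcons : ∀ V : GaugeField S.P k G, avgUp W.toRunObjects k (W.UkH k (W.triv k) V) = V)
    (hthr : S.gk k * B10.pFun W.b₀ W.p₀ (S.gk k) ≤ W.ε₁ k) : W.Chi47SubChi4 k :=
  chi47SubChi4_of_axial W k hk
    (fun V => by rw [← avgUp_eq_axialUp W.toRunObjects hav hk]; exact hcons V) hthr

/-- **The case of the lane's standard external inputs** (`W.av = AveragingRT.stdAvg`, as for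
`Balaban3D.Carriers.ExternalInputs.ofStd`): (42) for the run's averaging + `g_kp(g_k) ≤ ε₁(k)` give `W.Chi47SubChi4 k`, hence the
tree's (47) implies (47) AS PRINTED. [cite: Balaban1985UV3, (47) p.267 + (42) p.266] -/
theorem ineq47Literal_of_asPrinted_stdAvg (k : ℕ) (hk : k ≤ S.m + S.K)
    (hav : ∀ i, W.av i = AveragingRT.stdAvg S.P G i)
    (hcons : ∀ V : GaugeField S.P k G, avgUp W.toRunObjects k (W.UkH k (W.triv k) V) = V)
    (hthr : S.gk k * B10.pFun W.b₀ W.p₀ (S.gk k) ≤ W.ε₁ k) (h : W.Ineq47AsPrinted k) : W.Ineq47Literal k :=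
  W.ineq47Literal_of_asPrinted k
    (chi47SubChi4_of_avgUp W k hk (fun i hi => by rw [hav i]; exact stdAvg_avg_of_le (S := S) hi) hcons hthr) h

/-! ## §5 The converse inclusion from the regularity of the minimizer (in-edge [7] Thm 1, hypothesis-shaped) -/

/-- **`Chi4SubChi47` FROM THE REGULARITY OF THE MINIMIZER** in the shape of [Balaban1985Variational] Thm 1 (8) with (2)
p. 278 (no large fields: a `V` in the (4)-domain at `ε₁(k)` has its minimizer `U_k(V)` in the space «|U(∂p) − 1| <
B₃ε₁η²» on `T_η`) — the hypothesis `hreg` on the binder `W.UkH k (W.triv k)`, NOT proved here (in-edge b11 of node N08) —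
at thresholds `B₃ε₁(k) ≤ g_kp(g_k)` (`hthr`).  Recorded next to §4 to display the asymmetry of G-pv15-1: at the lane's
`ε₁(k) = g_kp(g_k)` and `B₃ ≥ 1` only §4's direction is available. [cite: Balaban1985Variational, Thm 1 (8) p.279 + (2) p.278] -/
theorem chi4SubChi47_of_regularity (k : ℕ) {B₃ : ℝ}
    (hreg : ∀ V : GaugeField S.P k G, PlaqSmall (W.ε₁ k) V →
      PlaqSmall (B₃ * W.ε₁ k * S.eta k ^ 2) (W.UkH k (W.triv k) V))
    (hthr : B₃ * W.ε₁ k ≤ S.gk k * B10.pFun W.b₀ W.p₀ (S.gk k)) : W.Chi4SubChi47 k := by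
  intro V hV
  have h := hreg V hV
  exact plaqSmall_mono (mul_le_mul_of_nonneg_right hthr (sq_nonneg _)) h

/-- Under both hypotheses (42)-for-the-axial-averaging and [7]-regularity, with `B₃ε₁(k) ≤ g_kp(g_k) ≤ ε₁(k)` (possible
only for `B₃ ≤ 1`), the two readings of (47) coincide. [cite: Balaban1985UV3, (47) p.267] -/
theorem ineq47Literal_iff_asPrinted_axial (k : ℕ) (hk : k ≤ S.m + S.K) {B₃ : ℝ}
    (hcons : ∀ V : GaugeField S.P k G, axialUp k (W.UkH k (W.triv k) V) = V)
    (hreg : ∀ V : GaugeField S.P k G, PlaqSmall (W.ε₁ k) V →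
      PlaqSmall (B₃ * W.ε₁ k * S.eta k ^ 2) (W.UkH k (W.triv k) V))
    (hthr₁ : B₃ * W.ε₁ k ≤ S.gk k * B10.pFun W.b₀ W.p₀ (S.gk k))
    (hthr₂ : S.gk k * B10.pFun W.b₀ W.p₀ (S.gk k) ≤ W.ε₁ k) :
    W.Ineq47Literal k ↔ W.Ineq47AsPrinted k :=
  W.ineq47Literal_iff_asPrinted k (chi4SubChi47_of_regularity W k hreg hthr₁)
    (chi47SubChi4_of_axial W k hk hcons hthr₂)

end Spine

end Literature.MathematicalPhysics.QuantumFieldTheory.Balaban1983to89.B10Eq47AxialChi
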